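import Literature.Topology.FourManifolds.CobordismAttachmentUniqueness
import Literature.Topology.FourManifolds.GluingConstructionBoundary
import HarnessLib

/-!
# Extending an attachment `W ∪_ψ X` by the second half of a composite cobordism `Y = X ∪_N X′`

Topic `Literature/Topology/FourManifolds`; a complement to `CobordismAttachment.lean` and
`CobordismAttachmentUniqueness.lean`.  Everything here is PROVED; no named facts.

Let `V = W ∪_ψ X` be an attachment (`A : CobordismAttachment b X ψ V`) of the cobordism `X` from
`M` to `N`, and let `Y` be a composite of `X` and a cobordism `X′` from `N` to `P`
(`Cobordism.IsComposite Y X X′`, witnessed by `D : Cobordism.CompositeData Y X X′`: smooth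
embeddings `j : X → Y`, `j′ : X′ → Y` covering `Y`, meeting exactly along `N`, compatible with
the ends).  We construct a compact Hausdorff smooth manifold with boundary `T` which is AT THE
SAME TIME

* an attachment of `Y` to `W` along `ψ` (`extensionAttachmentY : CobordismAttachment b Y ψ T`),
* an attachment of `X′` to `V` along the identity of `∂V = N`
  (`extensionAttachmentX' : CobordismAttachment A.boundaryData X′ (refl N) T`),

with the two structures sharing the copy of `X′` (`jX (x′) = jY (j′ x′)`), the copy of `W`
(`jW w = jV (jW_A w)`) and the copy of `X` (`jV (jX_A x) = jY (j x)`).  In words: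
**`(W ∪_ψ X) ∪_N X′ = W ∪_ψ (X ∪_N X′)` for a suitable common witness `T`**, whatever the smooth
structures of `V` near its seam and of `Y` near its seam are — the point being that `T` is glued
from `V` and `Y` along the INTERIOR of `X` (an open gluing of the open pieces `V - ∂V` and
`Y - inl M`, `GluingConstructionBoundary.lean`), so that both given structures are inherited on
the nose and no compatibility of collars is needed.  This is the "associativity" of Milnor's
gluing of triads (*Lectures on the h-cobordism theorem* (1965), §1, Thm. 1.4 and the paragraph
after Def. 1.5, `(W ∪ W′) ∪ W″ = W ∪ (W′ ∪ W″)`), in the witness style of the tree; combined with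
the uniqueness theorem of `CobordismAttachmentUniqueness.lean` it lets one re-bracket iterated
attachments.  Used in the discharge of
`Literature.Barriers.SmoothPoincare4.akbulutRuberman2016_relativelyExotic` (Akbulut–Ruberman
(2016), §3: `V′ ∪_N X̄ = W ∪_f (X ∪_N X̄)`).

## Main definitions and results

* `Cobordism.CompositeData Y X X′` — witnesses of `Y.IsComposite X X′`;
  `IsComposite.nonempty_compositeData`.
* `CobordismAttachment.extGlueData A D` — the open gluing datum of `Int V` and `Y - inl M` along
  `Int X`; `T A D` — the glued manifold with boundary; `t2Space_T`, `compactSpace_T`,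
  `secondCountable_T`, `boundary_T`.
* `CobordismAttachment.tV : V → T`, `tY : Y → T` — the two pieces, smooth embeddings
  (`isSmoothEmbedding_tV`, `isSmoothEmbedding_tY`) meeting exactly along the copy of `X`
  (`tV_eq_tY_iff`).
* `CobordismAttachment.extensionAttachmentY`, `extensionAttachmentX'` and the compatibility
  lemmas `extensionAttachmentY_jW`, `extensionAttachmentY_jX`, `extensionAttachmentX'_jW`,
  `extensionAttachmentX'_jX`, `tV_jX`.

## References

* J. Milnor, *Lectures on the h-cobordism theorem*, Princeton (1965), §1, Thm. 1.4, Def. 1.5.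
  [MilnorHCobordism1965]
* A. Kosinski, *Differential Manifolds* (1993), Ch. VI §1. [Kosinski1993]
-/

open scoped Manifold ContDiff Topology
open Set Function Filter Topology

noncomputable section

namespace Literature.Topology.FourManifolds

universe u

/-- Local notation: `𝔼 n` is the model Euclidean space `EuclideanSpace ℝ (Fin n)`. -/
local notation "𝔼 " n:arg => EuclideanSpace ℝ (Fin n)
/-- Local notation: `ℍ n` is the closed half space `EuclideanHalfSpace n`. -/
local notation "ℍ " n:arg => EuclideanHalfSpace n

/-! ### Witnesses of a composite cobordism -/

namespace Cobordism

variable {n : ℕ} {M N P : Type u} [TopologicalSpace M] [ChartedSpace (𝔼 n) M]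
  [TopologicalSpace N] [ChartedSpace (𝔼 n) N] [TopologicalSpace P] [ChartedSpace (𝔼 n) P]

/-- **Witnesses that `Y = X ∪_N X′` as cobordisms** (the data in `Cobordism.IsComposite`): smooth
embeddings `j : X → Y`, `j′ : X′ → Y` covering `Y`, meeting exactly along `N`, compatible with
the end markings. [cite: MilnorHCobordism1965, §1, Thm. 1.4 and Def. 1.5] -/
structure CompositeData (Y : Cobordism n M P) (X : Cobordism n M N) (X' : Cobordism n N P) where
  /-- The embedding of the first cobordism. -/
  j : X.W → Y.W
  /-- The embedding of the second cobordism. -/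
  j' : X'.W → Y.W
  isSmoothEmbedding_j : Manifold.IsSmoothEmbedding (𝓡∂ (n + 1)) (𝓡∂ (n + 1)) ∞ j
  isSmoothEmbedding_j' : Manifold.IsSmoothEmbedding (𝓡∂ (n + 1)) (𝓡∂ (n + 1)) ∞ j'
  range_union : range j ∪ range j' = univ
  j_eq_j'_iff : ∀ x x', j x = j' x' ↔ ∃ y, x = X.inr y ∧ x' = X'.inl y
  j_inl : ∀ m, j (X.inl m) = Y.inl m
  j'_inr : ∀ p, j' (X'.inr p) = Y.inr p

/-- A composite admits composite data. [folklore] -/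
theorem IsComposite.nonempty_compositeData {Y : Cobordism n M P} {X : Cobordism n M N}
    {X' : Cobordism n N P} (h : Y.IsComposite X X') : Nonempty (CompositeData Y X X') := by
  obtain ⟨j, j', hj, hj', hU, hR, hl, hr⟩ := h
  exact ⟨⟨j, j', hj, hj', hU, hR, hl, hr⟩⟩

namespace CompositeData

variable {Y : Cobordism n M P} {X : Cobordism n M N} {X' : Cobordism n N P}
  (D : CompositeData Y X X')

/-- `j` is injective. [folklore] -/
theorem injective_j : Injective D.j := D.isSmoothEmbedding_j.isEmbedding.injective

/-- `j′` is injective. [folklore] -/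
theorem injective_j' : Injective D.j' := D.isSmoothEmbedding_j'.isEmbedding.injective

/-- `j` is continuous. [folklore] -/
theorem continuous_j : Continuous D.j := D.isSmoothEmbedding_j.isEmbedding.continuous

/-- `j′` is continuous. [folklore] -/
theorem continuous_j' : Continuous D.j' := D.isSmoothEmbedding_j'.isEmbedding.continuous

/-- The seam of the composite: `j (inr y) = j′ (inl y)`. [folklore] -/
theorem j_inr (y : N) : D.j (X.inr y) = D.j' (X'.inl y) := (D.j_eq_j'_iff _ _).2 ⟨y, rfl, rfl⟩

/-- `j x` lies on the second cobordism iff `x` lies on the far end of the first. [folklore] -/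
theorem j_mem_range_j'_iff (x : X.W) : D.j x ∈ range D.j' ↔ x ∈ range X.inr := by
  constructor
  · rintro ⟨x', hx'⟩
    obtain ⟨y, rfl, -⟩ := (D.j_eq_j'_iff x x').1 hx'.symm
    exact mem_range_self y
  · rintro ⟨y, rfl⟩
    exact ⟨X'.inl y, (D.j_inr y).symm⟩

/-- `j′ x′` lies on the first cobordism iff `x′` lies on the incoming end of the second.
[folklore] -/
theorem j'_mem_range_j_iff (x' : X'.W) : D.j' x' ∈ range D.j ↔ x' ∈ range X'.inl := by
  constructor
  · rintro ⟨x, hx⟩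
    obtain ⟨y, -, rfl⟩ := (D.j_eq_j'_iff x x').1 hx
    exact mem_range_self y
  · rintro ⟨y, rfl⟩
    exact ⟨X.inr y, D.j_inr y⟩

/-- `j x` lies on the incoming end of `Y` iff `x` lies on the incoming end of `X`. [folklore] -/
theorem j_mem_range_inl_iff (x : X.W) : D.j x ∈ range Y.inl ↔ x ∈ range X.inl := by
  constructor
  · rintro ⟨m, hm⟩
    rw [← D.j_inl] at hm
    exact ⟨m, D.injective_j hm⟩
  · rintro ⟨m, rfl⟩
    exact ⟨m, (D.j_inl m).symm⟩

/-- `j′ x′` never lies on the incoming end of `Y`. [folklore] -/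
theorem j'_not_mem_range_inl (x' : X'.W) : D.j' x' ∉ range Y.inl := by
  rintro ⟨m, hm⟩
  rw [← D.j_inl] at hm
  obtain ⟨y, hy, -⟩ := (D.j_eq_j'_iff _ _).1 hm
  exact Set.disjoint_left.1 X.disjoint_range (mem_range_self m) ⟨y, hy.symm⟩

/-- The image under `j` of the complement of the far end is the complement of the second
cobordism. [folklore] -/
theorem image_j_compl_range_inr : D.j '' (range X.inr)ᶜ = (range D.j')ᶜ := by
  ext y
  constructor
  · rintro ⟨x, hx, rfl⟩ h
    exact hx ((D.j_mem_range_j'_iff x).1 h)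
  · intro hy
    have hy' : y ∈ range D.j := (D.range_union.symm.subset (mem_univ y)).resolve_right hy
    obtain ⟨x, rfl⟩ := hy'
    exact ⟨x, fun h => hy ((D.j_mem_range_j'_iff x).2 h), rfl⟩

/-- The image under `j` of the interior of `X` is open in `Y`: it is the complement of the
compact set `j′ (X′) ∪ inl (M)`. [folklore] -/
theorem image_j_interior : D.j '' (𝓡∂ (n + 1)).interior X.W = (range D.j' ∪ range Y.inl)ᶜ := by
  ext y
  constructor
  · rintro ⟨x, hx, rfl⟩ h
    have hx' : x ∉ (𝓡∂ (n + 1)).boundary X.W := by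
      rw [← ModelWithCorners.compl_interior, mem_compl_iff, not_not]
      exact hx
    rw [← X.range_inl_union_range_inr, mem_union, not_or] at hx'
    obtain ⟨h1, h2⟩ := hx'
    rcases h with h | h
    · exact h2 ((D.j_mem_range_j'_iff x).1 h)
    · exact h1 ((D.j_mem_range_inl_iff x).1 h)
  · intro hy
    rw [mem_compl_iff, mem_union, not_or] at hy
    have hy' : y ∈ range D.j := (D.range_union.symm.subset (mem_univ y)).resolve_right hy.1
    obtain ⟨x, rfl⟩ := hy'
    refine ⟨x, ?_, rfl⟩
    have h1 : x ∉ range X.inr := fun h => hy.1 ((D.j_mem_range_j'_iff x).2 h)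
    have h2 : x ∉ range X.inl := fun h => hy.2 ((D.j_mem_range_inl_iff x).2 h)
    have : x ∉ (𝓡∂ (n + 1)).boundary X.W := by
      rw [← X.range_inl_union_range_inr]
      rintro (h | h)
      exacts [h2 h, h1 h]
    rwa [← ModelWithCorners.compl_interior, mem_compl_iff, not_not] at this

/-- `j (Int X)` is open. [folklore] -/
theorem isOpen_image_j_interior : IsOpen (D.j '' (𝓡∂ (n + 1)).interior X.W) := by
  haveI : CompactSpace M := X.compactSpace_of_inl
  rw [D.image_j_interior]
  exact ((isCompact_range D.continuous_j').union (isCompact_range Y.continuous_inl)).isClosed.isOpen_compl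

/-- `j (X - inr N)` is open. [folklore] -/
theorem isOpen_image_j_compl_range_inr : IsOpen (D.j '' (range X.inr)ᶜ) := by
  rw [D.image_j_compl_range_inr]
  exact (isCompact_range D.continuous_j').isClosed.isOpen_compl

end CompositeData

/-- The boundary of a cobordism off the incoming end is the far end. [folklore] -/
theorem mem_range_inr_of_mem_boundary (Y : Cobordism n M P) {y : Y.W}
    (hy : y ∈ (𝓡∂ (n + 1)).boundary Y.W) (hy' : y ∉ range Y.inl) : y ∈ range Y.inr := by
  rw [← Y.range_inl_union_range_inr] at hy
  exact hy.resolve_left hy'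

end Cobordism

namespace CobordismAttachment

/-! ### The open gluing of `Int V` and `Y - inl M` along `Int X` -/

section Extension

variable {n : ℕ} {W : Type u} [TopologicalSpace W] [ChartedSpace (ℍ (n + 1 + 1)) W]
  {M N P : Type u} [TopologicalSpace M] [ChartedSpace (𝔼 (n + 1)) M]
  [TopologicalSpace N] [ChartedSpace (𝔼 (n + 1)) N] [TopologicalSpace P] [ChartedSpace (𝔼 (n + 1)) P]
  {b : BoundaryData (𝓡∂ (n + 1 + 1)) W (𝓡 (n + 1))} {X : Cobordism (n + 1) M N}
  {ψ : b.carrier ≃ₘ⟮𝓡 (n + 1), 𝓡 (n + 1)⟯ M}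
  {V : Type u} [TopologicalSpace V] [ChartedSpace (ℍ (n + 1 + 1)) V]
  {X' : Cobordism (n + 1) N P} {Y : Cobordism (n + 1) M P}
  (A : CobordismAttachment b X ψ V) (D : Cobordism.CompositeData Y X X')

/-- The interior of `V`, an open submanifold (with the same half-space model). [folklore] -/
def intOpens (V : Type u) [TopologicalSpace V] [ChartedSpace (ℍ (n + 1 + 1)) V]
    [IsManifold (𝓡∂ (n + 1 + 1)) ∞ V] : TopologicalSpace.Opens V :=
  ⟨(𝓡∂ (n + 1 + 1)).interior V, InteriorManifold.isOpen_interior_carrier⟩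

/-- Membership in `intOpens` (definitional). [folklore] -/
theorem mem_intOpens_iff [IsManifold (𝓡∂ (n + 1 + 1)) ∞ V] {v : V} :
    v ∈ intOpens (n := n) V ↔ (𝓡∂ (n + 1 + 1)).IsInteriorPoint v := Iff.rfl

variable [IsManifold (𝓡∂ (n + 1 + 1)) ∞ V]

/-- **The interior of `X` embedded in `Int V`.** [folklore] -/
def gA (x : X.interiorOpens) : intOpens (n := n) V :=
  ⟨A.jX x.val, A.isInteriorPoint_jX_of_isInteriorPoint x.2⟩

/-- **The interior of `X` embedded in `Y - inl M`.** [folklore] -/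
def gB (x : X.interiorOpens) : Y.offInl :=
  ⟨D.j x.val, fun h => (X.not_mem_range_of_isInteriorPoint x.2).1 ((D.j_mem_range_inl_iff _).1 h)⟩

/-- The underlying point of `gA x` (definitional). [folklore] -/
@[simp] theorem gA_val (x : X.interiorOpens) : (gA A x).val = A.jX x.val := rfl

/-- The underlying point of `gB x` (definitional). [folklore] -/
@[simp] theorem gB_val (x : X.interiorOpens) : (gB D x).val = D.j x.val := rfl

/-- `gA` is a smooth embedding. [folklore] -/
theorem isSmoothEmbedding_gA :
    Manifold.IsSmoothEmbedding (𝓡∂ (n + 1 + 1)) (𝓡∂ (n + 1 + 1)) ∞ (gA A) := by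
  have hval : Manifold.IsSmoothEmbedding (𝓡∂ (n + 1 + 1)) (𝓡∂ (n + 1 + 1)) ∞
      (Subtype.val : X.interiorOpens → X.W) := Manifold.IsSmoothEmbedding.of_opens _
  have ho : IsOpen (range (Subtype.val : X.interiorOpens → X.W)) := by
    rw [Subtype.range_coe_subtype]; exact X.interiorOpens.isOpen
  have h : Manifold.IsSmoothEmbedding (𝓡∂ (n + 1 + 1)) (𝓡∂ (n + 1 + 1)) ∞
      (fun x : X.interiorOpens => A.jX x.val) :=
    IsSmoothEmbedding.comp_of_isOpen_range A.isSmoothEmbedding_jX hval ho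
  exact isSmoothEmbedding_codRestrict_of_forall_mem h (intOpens (n := n) V) _

/-- `gB` is a smooth embedding. [folklore] -/
theorem isSmoothEmbedding_gB :
    Manifold.IsSmoothEmbedding (𝓡∂ (n + 1 + 1)) (𝓡∂ (n + 1 + 1)) ∞ (gB D) := by
  have hval : Manifold.IsSmoothEmbedding (𝓡∂ (n + 1 + 1)) (𝓡∂ (n + 1 + 1)) ∞
      (Subtype.val : X.interiorOpens → X.W) := Manifold.IsSmoothEmbedding.of_opens _
  have ho : IsOpen (range (Subtype.val : X.interiorOpens → X.W)) := by
    rw [Subtype.range_coe_subtype]; exact X.interiorOpens.isOpen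
  have h : Manifold.IsSmoothEmbedding (𝓡∂ (n + 1 + 1)) (𝓡∂ (n + 1 + 1)) ∞
      (fun x : X.interiorOpens => D.j x.val) :=
    IsSmoothEmbedding.comp_of_isOpen_range D.isSmoothEmbedding_j hval ho
  exact isSmoothEmbedding_codRestrict_of_forall_mem h Y.offInl _

variable [CompactSpace W] [T2Space V]

/-- The range of `gA` is open. [folklore] -/
theorem isOpen_range_gA : IsOpen (range (gA A)) := by
  haveI : CompactSpace M := X.compactSpace_of_inl
  have h : range (gA A) = Subtype.val ⁻¹' (A.jX '' (𝓡∂ (n + 1 + 1)).interior X.W) := by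
    ext p
    constructor
    · rintro ⟨x, rfl⟩
      exact ⟨x.val, x.2, rfl⟩
    · rintro ⟨x, hx, hp⟩
      exact ⟨⟨x, hx⟩, Subtype.ext hp⟩
  rw [h]
  exact A.isOpen_image_jX_interior.preimage continuous_subtype_val

omit [IsManifold (𝓡∂ (n + 1 + 1)) ∞ V] [CompactSpace W] [T2Space V] in
/-- The range of `gB` is open. [folklore] -/
theorem isOpen_range_gB : IsOpen (range (gB D)) := by
  have h : range (gB D) = Subtype.val ⁻¹' (D.j '' (𝓡∂ (n + 1 + 1)).interior X.W) := by
    ext p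
    constructor
    · rintro ⟨x, rfl⟩
      exact ⟨x.val, x.2, rfl⟩
    · rintro ⟨x, hx, hp⟩
      exact ⟨⟨x, hx⟩, Subtype.ext hp⟩
  rw [h]
  exact D.isOpen_image_j_interior.preimage continuous_subtype_val

/-- `gA` is an open embedding. [folklore] -/
theorem isOpenEmbedding_gA : IsOpenEmbedding (gA A) :=
  ⟨(isSmoothEmbedding_gA A).isEmbedding, isOpen_range_gA A⟩

omit [IsManifold (𝓡∂ (n + 1 + 1)) ∞ V] [CompactSpace W] [T2Space V] in
/-- `gB` is an open embedding. [folklore] -/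
theorem isOpenEmbedding_gB : IsOpenEmbedding (gB D) :=
  ⟨(isSmoothEmbedding_gB D).isEmbedding, isOpen_range_gB D⟩

variable [Nonempty X.W]

/-- **The gluing datum**: `Int V` and `Y - inl M` glued along the partial diffeomorphism
`gA x ↦ gB x` of the two copies of `Int X`. [folklore] -/
def extGlueData : SmoothGlueData (𝓡∂ (n + 1 + 1)) (𝓡∂ (n + 1 + 1)) (intOpens (n := n) V) Y.offInl
    (𝔼 (n + 1 + 1)) where
  glue := ((isOpenEmbedding_gA A).toOpenPartialHomeomorph (gA A)).symm ≫ₕ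
    (isOpenEmbedding_gB D).toOpenPartialHomeomorph (gB D)
  contMDiffOn_glue := by
    have h1 : ContMDiffOn (𝓡∂ (n + 1 + 1)) (𝓡∂ (n + 1 + 1)) ∞
        ((isOpenEmbedding_gA A).toOpenPartialHomeomorph (gA A)).symm (range (gA A)) :=
      contMDiffOn_symm_of_isSmoothEmbedding (isSmoothEmbedding_gA A) (isOpenEmbedding_gA A)
    have h2 : ContMDiff (𝓡∂ (n + 1 + 1)) (𝓡∂ (n + 1 + 1)) ∞
        ((isOpenEmbedding_gB D).toOpenPartialHomeomorph (gB D)) := by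
      rw [IsOpenEmbedding.toOpenPartialHomeomorph_apply]
      exact (isSmoothEmbedding_gB D).contMDiff
    refine (h2.comp_contMDiffOn h1).mono ?_
    intro p hp
    simp only [OpenPartialHomeomorph.trans_source, OpenPartialHomeomorph.symm_source,
      IsOpenEmbedding.toOpenPartialHomeomorph_target, mem_inter_iff] at hp
    exact hp.1
  contMDiffOn_glue_symm := by
    have h1 : ContMDiffOn (𝓡∂ (n + 1 + 1)) (𝓡∂ (n + 1 + 1)) ∞
        ((isOpenEmbedding_gB D).toOpenPartialHomeomorph (gB D)).symm (range (gB D)) :=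
      contMDiffOn_symm_of_isSmoothEmbedding (isSmoothEmbedding_gB D) (isOpenEmbedding_gB D)
    have h2 : ContMDiff (𝓡∂ (n + 1 + 1)) (𝓡∂ (n + 1 + 1)) ∞
        ((isOpenEmbedding_gA A).toOpenPartialHomeomorph (gA A)) := by
      rw [IsOpenEmbedding.toOpenPartialHomeomorph_apply]
      exact (isSmoothEmbedding_gA A).contMDiff
    refine (h2.comp_contMDiffOn h1).mono ?_
    intro p hp
    simp only [OpenPartialHomeomorph.trans_target, OpenPartialHomeomorph.symm_target,
      IsOpenEmbedding.toOpenPartialHomeomorph_target, mem_inter_iff] at hp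
    exact hp.1
  linA := ContinuousLinearEquiv.refl ℝ _
  linB := ContinuousLinearEquiv.refl ℝ _

/-- **The extended manifold `T = Int V ∪_{Int X} (Y - inl M)`.** [folklore] -/
abbrev T : Type u := (extGlueData A D).Glued

/-- The source of the gluing map is the copy of `Int X` in `Int V`. [folklore] -/
theorem extGlueData_source : (extGlueData A D).glue.source = range (gA A) := by
  simp [extGlueData]

/-- The gluing map sends `gA x` to `gB x`. [folklore] -/
theorem extGlueData_glue_gA (x : X.interiorOpens) : (extGlueData A D).glue (gA A x) = gB D x := by
  simp only [extGlueData, OpenPartialHomeomorph.trans_apply,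
    IsOpenEmbedding.toOpenPartialHomeomorph_apply]
  rw [(isOpenEmbedding_gA A).toOpenPartialHomeomorph_left_inv]

/-- **The two copies of `Int X` are identified**: `inl (gA x) = inr (gB x)`. [folklore] -/
theorem inl_gA (x : X.interiorOpens) :
    (extGlueData A D).inl (gA A x) = (extGlueData A D).inr (gB D x) := by
  rw [SmoothGlueData.inl_eq_inr_iff, extGlueData_source]
  exact ⟨mem_range_self x, extGlueData_glue_gA A D x⟩

/-- `inl p = inr q` iff `p = gA x`, `q = gB x` for some `x ∈ Int X`. [folklore] -/
theorem inl_eq_inr_iff'' {p : intOpens (n := n) V} {q : Y.offInl} :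
    (extGlueData A D).inl p = (extGlueData A D).inr q ↔ ∃ x, p = gA A x ∧ q = gB D x := by
  rw [SmoothGlueData.inl_eq_inr_iff, extGlueData_source]
  constructor
  · rintro ⟨⟨x, rfl⟩, h⟩
    exact ⟨x, rfl, by rw [← h, extGlueData_glue_gA]⟩
  · rintro ⟨x, rfl, rfl⟩
    exact ⟨mem_range_self x, extGlueData_glue_gA A D x⟩

/-- **The extended manifold is Hausdorff.** [folklore] -/
instance t2Space_T : T2Space (T A D) := by
  apply SmoothGlueData.t2Space_of_isClosed_graph
  have hΓ : IsClosed ((fun x : X.W => (A.jX x, D.j x)) '' univ) :=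
    ((isCompact_univ.image (A.continuous_jX.prodMk D.continuous_j))).isClosed
  have heq : {p : intOpens (n := n) V × Y.offInl |
      p.1 ∈ (extGlueData A D).glue.source ∧ (extGlueData A D).glue p.1 = p.2} =
      (fun p => (p.1.val, p.2.val)) ⁻¹' ((fun x : X.W => (A.jX x, D.j x)) '' univ) := by
    ext ⟨p, q⟩
    simp only [mem_setOf_eq, mem_preimage, mem_image, mem_univ, true_and, Prod.mk.injEq]
    rw [extGlueData_source]
    constructor
    · rintro ⟨⟨x, rfl⟩, h⟩
      rw [extGlueData_glue_gA] at h
      exact ⟨x.val, rfl, by rw [← h]; rfl⟩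
    · rintro ⟨x, hx1, hx2⟩
      have hxr : x ∉ range X.inr := (A.isInteriorPoint_jX_iff x).1 (hx1 ▸ p.property)
      have hxl : x ∉ range X.inl := fun h => q.property (hx2 ▸ (D.j_mem_range_inl_iff x).2 h)
      have hx : (𝓡∂ (n + 1 + 1)).IsInteriorPoint x := by
        have h' : x ∉ (𝓡∂ (n + 1 + 1)).boundary X.W := by
          rw [← X.range_inl_union_range_inr]
          rintro (h | h)
          exacts [hxl h, hxr h]
        rwa [← ModelWithCorners.compl_interior, mem_compl_iff, not_not] at h'
      refine ⟨⟨⟨x, hx⟩, Subtype.ext hx1⟩, ?_⟩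
      rw [show p = gA A ⟨x, hx⟩ from Subtype.ext hx1.symm, extGlueData_glue_gA]
      exact Subtype.ext hx2
  rw [heq]
  exact hΓ.preimage (continuous_subtype_val.prodMap continuous_subtype_val)

/-! ### The pieces `V` and `Y` inside `T` -/

/-- The inverse of the embedding `j : X → Y`. [folklore] -/
def jinv (D : Cobordism.CompositeData Y X X') : Y.W → X.W := Function.invFun D.j

omit [IsManifold (𝓡∂ (n + 1 + 1)) ∞ V] [CompactSpace W] [T2Space V] in
/-- `jinv (j x) = x`. [folklore] -/
@[simp] theorem jinv_j (x : X.W) : jinv D (D.j x) = x :=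
  Function.leftInverse_invFun D.injective_j x

/-- A base point of `Int V`. [folklore] -/
def ptA : intOpens (n := n) V := gA A (Classical.arbitrary _)

/-- A base point of `Y - inl M`. [folklore] -/
def ptB : Y.offInl := gB D (Classical.arbitrary _)

open Classical in
/-- The map `V → Int V` which is the identity on the interior. [folklore] -/
def toA (v : V) : intOpens (n := n) V := if h : (𝓡∂ (n + 1 + 1)).IsInteriorPoint v then ⟨v, h⟩ else ptA A

open Classical in
/-- The map `Y → Y - inl M` which is the identity off `inl M`. [folklore] -/
def toB (y : Y.W) : Y.offInl := if h : y ∉ range Y.inl then ⟨y, h⟩ else ptB D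

/-- **The embedding of `V` into `T`**: `inl` on the interior of `V`, `jX x ↦ inr (j x)` near the
boundary `∂V = jX (inr N)`. [folklore] -/
def tV (v : V) : T A D :=
  haveI := Classical.propDecidable
  if (𝓡∂ (n + 1 + 1)).IsInteriorPoint v then (extGlueData A D).inl (toA A v)
  else (extGlueData A D).inr (toB D (D.j (A.jXinv v)))

/-- **The embedding of `Y` into `T`**: `inr` off `inl M`, `j x ↦ inl (jX x)` near `inl M`.
[folklore] -/
def tY (y : Y.W) : T A D :=
  haveI := Classical.propDecidable
  if y ∉ range Y.inl then (extGlueData A D).inr (toB D y)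
  else (extGlueData A D).inl (toA A (A.jX (jinv D y)))

/-- `tV` on interior points. [folklore] -/
theorem tV_of_isInteriorPoint {v : V} (hv : (𝓡∂ (n + 1 + 1)).IsInteriorPoint v) :
    tV A D v = (extGlueData A D).inl ⟨v, hv⟩ := by
  rw [tV, if_pos hv, toA, dif_pos hv]

/-- `tY` off `inl M`. [folklore] -/
theorem tY_of_not_mem {y : Y.W} (hy : y ∉ range Y.inl) :
    tY A D y = (extGlueData A D).inr ⟨y, hy⟩ := by
  rw [tY, if_pos hy, toB, dif_pos hy]

omit [IsManifold (𝓡∂ (n + 1 + 1)) ∞ V] [CompactSpace W] [T2Space V] [Nonempty X.W] in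
/-- `j x` is off `inl M` for `x` off `inl M`. [folklore] -/
theorem j_not_mem {x : X.W} (hx : x ∉ range X.inl) : D.j x ∉ range Y.inl :=
  fun h => hx ((D.j_mem_range_inl_iff x).1 h)

/-- **`tV` on the copy of `X`, off the incoming end**: `tV (jX x) = inr (j x)`. [folklore] -/
theorem tV_jX {x : X.W} (hx : x ∉ range X.inl) :
    tV A D (A.jX x) = (extGlueData A D).inr ⟨D.j x, j_not_mem D hx⟩ := by
  by_cases h : (𝓡∂ (n + 1 + 1)).IsInteriorPoint (A.jX x)
  · rw [tV_of_isInteriorPoint A D h]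
    have hx' : (𝓡∂ (n + 1 + 1)).IsInteriorPoint x := A.isInteriorPoint_of_jX h hx
    exact inl_gA A D ⟨x, hx'⟩
  · rw [tV, if_neg h, jXinv_jX A, toB, dif_pos (j_not_mem D hx)]

/-- **`tY` on the copy of `X`, off the far end**: `tY (j x) = inl (jX x)`. [folklore] -/
theorem tY_j {x : X.W} (hx : x ∉ range X.inr) :
    tY A D (D.j x) = (extGlueData A D).inl ⟨A.jX x, isInteriorPoint_jX_V A hx⟩ := by
  by_cases h : D.j x ∉ range Y.inl
  · rw [tY_of_not_mem A D h]
    have hx' : (𝓡∂ (n + 1 + 1)).IsInteriorPoint x := by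
      have hxl : x ∉ range X.inl := fun h' => h ((D.j_mem_range_inl_iff x).2 h')
      have h' : x ∉ (𝓡∂ (n + 1 + 1)).boundary X.W := by
        rw [← X.range_inl_union_range_inr]
        rintro (h'' | h'')
        exacts [hxl h'', hx h'']
      rwa [← ModelWithCorners.compl_interior, mem_compl_iff, not_not] at h'
    exact (inl_gA A D ⟨x, hx'⟩).symm
  · rw [tY, if_neg h, jinv_j, toA, dif_pos (isInteriorPoint_jX_V A hx)]

/-- **The two copies of `X` agree in `T`**: `tV (jX x) = tY (j x)` for every `x`. [folklore] -/
theorem tV_jX_eq_tY_j (x : X.W) : tV A D (A.jX x) = tY A D (D.j x) := by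
  by_cases hx : x ∈ range X.inl
  · have hxr : x ∉ range X.inr := fun h => Set.disjoint_left.1 X.disjoint_range hx h
    rw [tY_j A D hxr, tV_of_isInteriorPoint A D (isInteriorPoint_jX_V A hxr)]
  · rw [tV_jX A D hx, tY_of_not_mem A D (j_not_mem D hx)]

/-- `tV` on the piece `W`. [folklore] -/
theorem tV_jW (w : W) :
    tV A D (A.jW w) = (extGlueData A D).inl ⟨A.jW w, A.isInteriorPoint_jW w⟩ :=
  tV_of_isInteriorPoint A D _

/-- `tY` on the second cobordism. [folklore] -/
theorem tY_j' (x' : X'.W) :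
    tY A D (D.j' x') = (extGlueData A D).inr ⟨D.j' x', D.j'_not_mem_range_inl x'⟩ :=
  tY_of_not_mem A D _

omit [IsManifold (𝓡∂ (n + 1 + 1)) ∞ V] [CompactSpace W] [T2Space V] [Nonempty X.W] in
/-- A point of `Y` on `inl M` is `j (inl m)`. [folklore] -/
theorem exists_eq_j_inl_of_mem {y : Y.W} (hy : ¬ y ∉ range Y.inl) : ∃ m, y = D.j (X.inl m) := by
  rw [not_not] at hy
  obtain ⟨m, rfl⟩ := hy
  exact ⟨m, (D.j_inl m).symm⟩

/-- **`tV` is injective.** [folklore] -/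
theorem injective_tV : Injective (tV A D) := by
  intro v₁ v₂ h
  by_cases h₁ : (𝓡∂ (n + 1 + 1)).IsInteriorPoint v₁ <;>
    by_cases h₂ : (𝓡∂ (n + 1 + 1)).IsInteriorPoint v₂
  · rw [tV_of_isInteriorPoint A D h₁, tV_of_isInteriorPoint A D h₂] at h
    exact congrArg Subtype.val ((extGlueData A D).inl_injective h)
  · obtain ⟨y, rfl⟩ := exists_eq_jX_inr_of_not A h₂
    rw [tV_of_isInteriorPoint A D h₁, tV_jX A D (X.inr_not_mem_range_inl y), inl_eq_inr_iff''] at h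
    obtain ⟨x, hx1, hx2⟩ := h
    have : X.inr y = x.val := D.injective_j (congrArg Subtype.val hx2)
    rw [this]
    exact congrArg Subtype.val hx1
  · obtain ⟨y, rfl⟩ := exists_eq_jX_inr_of_not A h₁
    rw [tV_of_isInteriorPoint A D h₂, tV_jX A D (X.inr_not_mem_range_inl y), eq_comm,
      inl_eq_inr_iff''] at h
    obtain ⟨x, hx1, hx2⟩ := h
    have : X.inr y = x.val := D.injective_j (congrArg Subtype.val hx2)
    rw [this]
    exact (congrArg Subtype.val hx1).symm
  · obtain ⟨y₁, rfl⟩ := exists_eq_jX_inr_of_not A h₁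
    obtain ⟨y₂, rfl⟩ := exists_eq_jX_inr_of_not A h₂
    rw [tV_jX A D (X.inr_not_mem_range_inl y₁), tV_jX A D (X.inr_not_mem_range_inl y₂)] at h
    have := congrArg Subtype.val ((extGlueData A D).inr_injective h)
    rw [D.injective_j this]

/-- **`tY` is injective.** [folklore] -/
theorem injective_tY : Injective (tY A D) := by
  intro y₁ y₂ h
  by_cases h₁ : y₁ ∉ range Y.inl <;> by_cases h₂ : y₂ ∉ range Y.inl
  · rw [tY_of_not_mem A D h₁, tY_of_not_mem A D h₂] at h
    exact congrArg Subtype.val ((extGlueData A D).inr_injective h)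
  · obtain ⟨m, rfl⟩ := exists_eq_j_inl_of_mem D h₂
    rw [tY_of_not_mem A D h₁, tY_j A D (X.inl_not_mem_range_inr m), eq_comm,
      inl_eq_inr_iff''] at h
    obtain ⟨x, hx1, hx2⟩ := h
    have : X.inl m = x.val := A.injective_jX (congrArg Subtype.val hx1)
    rw [this]
    exact congrArg Subtype.val hx2
  · obtain ⟨m, rfl⟩ := exists_eq_j_inl_of_mem D h₁
    rw [tY_of_not_mem A D h₂, tY_j A D (X.inl_not_mem_range_inr m), inl_eq_inr_iff''] at h
    obtain ⟨x, hx1, hx2⟩ := h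
    have : X.inl m = x.val := A.injective_jX (congrArg Subtype.val hx1)
    rw [this]
    exact (congrArg Subtype.val hx2).symm
  · obtain ⟨m₁, rfl⟩ := exists_eq_j_inl_of_mem D h₁
    obtain ⟨m₂, rfl⟩ := exists_eq_j_inl_of_mem D h₂
    rw [tY_j A D (X.inl_not_mem_range_inr m₁), tY_j A D (X.inl_not_mem_range_inr m₂)] at h
    have := congrArg Subtype.val ((extGlueData A D).inl_injective h)
    rw [A.injective_jX this]

/-- **The two pieces cover `T`.** [folklore] -/
theorem range_tV_union_range_tY : range (tV A D) ∪ range (tY A D) = univ := by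
  refine eq_univ_of_forall fun q => ?_
  rcases (extGlueData A D).exists_inl_or_inr q with ⟨p, rfl⟩ | ⟨p, rfl⟩
  · exact Or.inl ⟨p.val, tV_of_isInteriorPoint A D p.property⟩
  · exact Or.inr ⟨p.val, tY_of_not_mem A D p.property⟩

/-- **The two pieces meet exactly along the copy of `X`**: `tV v = tY y` iff `v = jX x` and
`y = j x` for some `x`. [folklore] -/
theorem tV_eq_tY_iff {v : V} {y : Y.W} : tV A D v = tY A D y ↔ ∃ x, v = A.jX x ∧ y = D.j x := by
  constructor
  · intro h
    by_cases hv : (𝓡∂ (n + 1 + 1)).IsInteriorPoint v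
    · by_cases hy : y ∉ range Y.inl
      · rw [tV_of_isInteriorPoint A D hv, tY_of_not_mem A D hy, inl_eq_inr_iff''] at h
        obtain ⟨x, hx1, hx2⟩ := h
        exact ⟨x.val, congrArg Subtype.val hx1, congrArg Subtype.val hx2⟩
      · obtain ⟨m, rfl⟩ := exists_eq_j_inl_of_mem D hy
        rw [tV_of_isInteriorPoint A D hv, tY_j A D (X.inl_not_mem_range_inr m)] at h
        exact ⟨X.inl m, congrArg Subtype.val ((extGlueData A D).inl_injective h), rfl⟩
    · obtain ⟨y', rfl⟩ := exists_eq_jX_inr_of_not A hv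
      refine ⟨X.inr y', rfl, ?_⟩
      rw [tV_jX_eq_tY_j] at h
      exact (injective_tY A D h).symm
  · rintro ⟨x, rfl, rfl⟩
    exact tV_jX_eq_tY_j A D x

/-! #### `tV` and `tY` are smooth embeddings -/

/-- The `Y`-side model of `tV` near the boundary: `inr ∘ (corestriction of j)` on `X - inl M`.
[folklore] -/
def fB (y : X.offInl) : T A D :=
  (extGlueData A D).inr ⟨D.j y.val, j_not_mem D y.2⟩

/-- The `V`-side model of `tY` near `inl M`: `inl ∘ (corestriction of jX)` on `X - inr N`.
[folklore] -/
def fA (y : X.offInr) : T A D :=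
  (extGlueData A D).inl ⟨A.jX y.val, isInteriorPoint_jX_V A y.2⟩

/-- `fB` is a smooth embedding. [folklore] -/
theorem isSmoothEmbedding_fB :
    Manifold.IsSmoothEmbedding (𝓡∂ (n + 1 + 1)) (𝓡∂ (n + 1 + 1)) ∞ (fB A D) := by
  have hval : Manifold.IsSmoothEmbedding (𝓡∂ (n + 1 + 1)) (𝓡∂ (n + 1 + 1)) ∞
      (Subtype.val : X.offInl → X.W) := Manifold.IsSmoothEmbedding.of_opens _
  have ho : IsOpen (range (Subtype.val : X.offInl → X.W)) := by
    rw [Subtype.range_coe_subtype]; exact X.offInl.isOpen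
  have h : Manifold.IsSmoothEmbedding (𝓡∂ (n + 1 + 1)) (𝓡∂ (n + 1 + 1)) ∞
      (fun y : X.offInl => D.j y.val) :=
    IsSmoothEmbedding.comp_of_isOpen_range D.isSmoothEmbedding_j hval ho
  exact (extGlueData A D).isSmoothEmbedding_inr_compH
    (isSmoothEmbedding_codRestrict_of_forall_mem h Y.offInl fun y => j_not_mem D y.2)

/-- `fA` is a smooth embedding. [folklore] -/
theorem isSmoothEmbedding_fA :
    Manifold.IsSmoothEmbedding (𝓡∂ (n + 1 + 1)) (𝓡∂ (n + 1 + 1)) ∞ (fA A D) := by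
  have hval : Manifold.IsSmoothEmbedding (𝓡∂ (n + 1 + 1)) (𝓡∂ (n + 1 + 1)) ∞
      (Subtype.val : X.offInr → X.W) := Manifold.IsSmoothEmbedding.of_opens _
  have ho : IsOpen (range (Subtype.val : X.offInr → X.W)) := by
    rw [Subtype.range_coe_subtype]; exact X.offInr.isOpen
  have h : Manifold.IsSmoothEmbedding (𝓡∂ (n + 1 + 1)) (𝓡∂ (n + 1 + 1)) ∞
      (fun y : X.offInr => A.jX y.val) :=
    IsSmoothEmbedding.comp_of_isOpen_range A.isSmoothEmbedding_jX hval ho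
  exact (extGlueData A D).isSmoothEmbedding_inl_compH
    (isSmoothEmbedding_codRestrict_of_forall_mem h (intOpens (n := n) V)
      fun y => isInteriorPoint_jX_V A y.2)

/-- The identity of `V` on its interior, corestricted, precomposed: `inl : Int V → T` is a smooth
embedding, and `tV` near an interior point is `inl` precomposed with the partial inverse of the
open embedding `val : Int V → V`. [folklore] -/
theorem isImmersionAtOfComplement_tV (v : V) :
    Manifold.IsImmersionAtOfComplement PUnit.{1} (𝓡∂ (n + 1 + 1)) (𝓡∂ (n + 1 + 1)) ∞
      (tV A D) v := by
  by_cases hv : (𝓡∂ (n + 1 + 1)).IsInteriorPoint v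
  · haveI : Nonempty (intOpens (n := n) V) := ⟨⟨v, hv⟩⟩
    have hvo : IsOpenEmbedding (Subtype.val : intOpens (n := n) V → V) :=
      (intOpens (n := n) V).isOpen.isOpenEmbedding_subtypeVal
    set Φ := hvo.toOpenPartialHomeomorph (Subtype.val : intOpens (n := n) V → V) with hΦ
    have hΦt : Φ.symm.source = range (Subtype.val : intOpens (n := n) V → V) := by
      rw [OpenPartialHomeomorph.symm_source, hΦ, IsOpenEmbedding.toOpenPartialHomeomorph_target]
    have hvalE : Manifold.IsSmoothEmbedding (𝓡∂ (n + 1 + 1)) (𝓡∂ (n + 1 + 1)) ∞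
        (Subtype.val : intOpens (n := n) V → V) := Manifold.IsSmoothEmbedding.of_opens _
    have hΦs : ContMDiffOn (𝓡∂ (n + 1 + 1)) (𝓡∂ (n + 1 + 1)) ∞ Φ.symm Φ.symm.source := by
      rw [hΦt, hΦ]
      exact contMDiffOn_symm_of_isSmoothEmbedding hvalE hvo
    have hΦs' : ContMDiffOn (𝓡∂ (n + 1 + 1)) (𝓡∂ (n + 1 + 1)) ∞ Φ.symm.symm Φ.symm.target := by
      rw [OpenPartialHomeomorph.symm_symm, OpenPartialHomeomorph.symm_target, hΦ,
        IsOpenEmbedding.toOpenPartialHomeomorph_apply]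
      exact hvalE.contMDiff.contMDiffOn
    have hmem : v ∈ Φ.symm.source := by
      rw [hΦt]; exact ⟨⟨v, hv⟩, rfl⟩
    have h0 : Manifold.IsImmersionAtOfComplement PUnit.{1} (𝓡∂ (n + 1 + 1)) (𝓡∂ (n + 1 + 1)) ∞
        (extGlueData A D).inl (Φ.symm v) :=
      (extGlueData A D).isSmoothEmbedding_inlH.isImmersionAtOfComplement_punit rfl _
    have h1 := h0.comp_openPartialHomeomorph Φ.symm hΦs hΦs' hmem
    refine h1.congr_of_eventuallyEq ?_
    filter_upwards [Φ.symm.open_source.mem_nhds hmem] with v' hv'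
    rw [hΦt] at hv'
    obtain ⟨z, rfl⟩ := hv'
    show (extGlueData A D).inl (Φ.symm z.val) = tV A D z.val
    rw [hΦ, hvo.toOpenPartialHomeomorph_left_inv, tV_of_isInteriorPoint A D z.2]
  · obtain ⟨y, rfl⟩ := exists_eq_jX_inr_of_not A hv
    haveI : Nonempty X.offInl := ⟨⟨X.inr y, X.inr_not_mem_range_inl y⟩⟩
    set Φ := (isOpenEmbedding_eXV A).toOpenPartialHomeomorph (eXV A) with hΦ
    have hΦt : Φ.symm.source = range (eXV A) := by
      rw [OpenPartialHomeomorph.symm_source, hΦ, IsOpenEmbedding.toOpenPartialHomeomorph_target]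
    have hΦs : ContMDiffOn (𝓡∂ (n + 1 + 1)) (𝓡∂ (n + 1 + 1)) ∞ Φ.symm Φ.symm.source := by
      rw [hΦt, hΦ]
      exact contMDiffOn_symm_of_isSmoothEmbedding (isSmoothEmbedding_eXV A) (isOpenEmbedding_eXV A)
    have hΦs' : ContMDiffOn (𝓡∂ (n + 1 + 1)) (𝓡∂ (n + 1 + 1)) ∞ Φ.symm.symm Φ.symm.target := by
      rw [OpenPartialHomeomorph.symm_symm, OpenPartialHomeomorph.symm_target, hΦ,
        IsOpenEmbedding.toOpenPartialHomeomorph_apply]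
      exact (isSmoothEmbedding_eXV A).contMDiff.contMDiffOn
    have hmem : A.jX (X.inr y) ∈ Φ.symm.source := by
      rw [hΦt]
      exact ⟨⟨X.inr y, X.inr_not_mem_range_inl y⟩, rfl⟩
    have h0 : Manifold.IsImmersionAtOfComplement PUnit.{1} (𝓡∂ (n + 1 + 1)) (𝓡∂ (n + 1 + 1)) ∞
        (fB A D) (Φ.symm (A.jX (X.inr y))) :=
      (isSmoothEmbedding_fB A D).isImmersionAtOfComplement_punit rfl _
    have h1 := h0.comp_openPartialHomeomorph Φ.symm hΦs hΦs' hmem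
    refine h1.congr_of_eventuallyEq ?_
    filter_upwards [Φ.symm.open_source.mem_nhds hmem] with v' hv'
    rw [hΦt] at hv'
    obtain ⟨z, rfl⟩ := hv'
    show fB A D (Φ.symm (eXV A z)) = tV A D (eXV A z)
    rw [hΦ, (isOpenEmbedding_eXV A).toOpenPartialHomeomorph_left_inv]
    show (extGlueData A D).inr _ = tV A D (A.jX z.val)
    rw [tV_jX A D z.2]

/-- The far part of `Y` embedded by `j′` restricted... : the open embedding `j|(X - inr N)`.
[folklore] -/
def eXY (y : X.offInr) : Y.W := D.j y.val

omit [IsManifold (𝓡∂ (n + 1 + 1)) ∞ V] [CompactSpace W] [T2Space V] [Nonempty X.W] in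
/-- `eXY` is a smooth embedding. [folklore] -/
theorem isSmoothEmbedding_eXY :
    Manifold.IsSmoothEmbedding (𝓡∂ (n + 1 + 1)) (𝓡∂ (n + 1 + 1)) ∞ (eXY D) := by
  have hval : Manifold.IsSmoothEmbedding (𝓡∂ (n + 1 + 1)) (𝓡∂ (n + 1 + 1)) ∞
      (Subtype.val : X.offInr → X.W) := Manifold.IsSmoothEmbedding.of_opens _
  have ho : IsOpen (range (Subtype.val : X.offInr → X.W)) := by
    rw [Subtype.range_coe_subtype]; exact X.offInr.isOpen
  exact IsSmoothEmbedding.comp_of_isOpen_range D.isSmoothEmbedding_j hval ho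

omit [IsManifold (𝓡∂ (n + 1 + 1)) ∞ V] [CompactSpace W] [T2Space V] [Nonempty X.W] in
/-- `eXY` is an open embedding. [folklore] -/
theorem isOpenEmbedding_eXY : IsOpenEmbedding (eXY D) := by
  refine ⟨(isSmoothEmbedding_eXY D).isEmbedding, ?_⟩
  have : range (eXY D) = D.j '' (range X.inr)ᶜ := by
    ext y
    constructor
    · rintro ⟨x, rfl⟩
      exact ⟨x.val, x.2, rfl⟩
    · rintro ⟨x, hx, rfl⟩
      exact ⟨⟨x, hx⟩, rfl⟩
  rw [this]
  exact D.isOpen_image_j_compl_range_inr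

/-- **`tY` is an immersion at every point** (complement `PUnit`). [folklore] -/
theorem isImmersionAtOfComplement_tY (y : Y.W) :
    Manifold.IsImmersionAtOfComplement PUnit.{1} (𝓡∂ (n + 1 + 1)) (𝓡∂ (n + 1 + 1)) ∞
      (tY A D) y := by
  by_cases hy : y ∉ range Y.inl
  · haveI : Nonempty Y.offInl := ⟨⟨y, hy⟩⟩
    have hvo : IsOpenEmbedding (Subtype.val : Y.offInl → Y.W) :=
      Y.offInl.isOpen.isOpenEmbedding_subtypeVal
    set Φ := hvo.toOpenPartialHomeomorph (Subtype.val : Y.offInl → Y.W) with hΦ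
    have hΦt : Φ.symm.source = range (Subtype.val : Y.offInl → Y.W) := by
      rw [OpenPartialHomeomorph.symm_source, hΦ, IsOpenEmbedding.toOpenPartialHomeomorph_target]
    have hvalE : Manifold.IsSmoothEmbedding (𝓡∂ (n + 1 + 1)) (𝓡∂ (n + 1 + 1)) ∞
        (Subtype.val : Y.offInl → Y.W) := Manifold.IsSmoothEmbedding.of_opens _
    have hΦs : ContMDiffOn (𝓡∂ (n + 1 + 1)) (𝓡∂ (n + 1 + 1)) ∞ Φ.symm Φ.symm.source := by
      rw [hΦt, hΦ]
      exact contMDiffOn_symm_of_isSmoothEmbedding hvalE hvo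
    have hΦs' : ContMDiffOn (𝓡∂ (n + 1 + 1)) (𝓡∂ (n + 1 + 1)) ∞ Φ.symm.symm Φ.symm.target := by
      rw [OpenPartialHomeomorph.symm_symm, OpenPartialHomeomorph.symm_target, hΦ,
        IsOpenEmbedding.toOpenPartialHomeomorph_apply]
      exact hvalE.contMDiff.contMDiffOn
    have hmem : y ∈ Φ.symm.source := by
      rw [hΦt]; exact ⟨⟨y, hy⟩, rfl⟩
    have h0 : Manifold.IsImmersionAtOfComplement PUnit.{1} (𝓡∂ (n + 1 + 1)) (𝓡∂ (n + 1 + 1)) ∞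
        (extGlueData A D).inr (Φ.symm y) :=
      (extGlueData A D).isSmoothEmbedding_inrH.isImmersionAtOfComplement_punit rfl _
    have h1 := h0.comp_openPartialHomeomorph Φ.symm hΦs hΦs' hmem
    refine h1.congr_of_eventuallyEq ?_
    filter_upwards [Φ.symm.open_source.mem_nhds hmem] with y' hy'
    rw [hΦt] at hy'
    obtain ⟨z, rfl⟩ := hy'
    show (extGlueData A D).inr (Φ.symm z.val) = tY A D z.val
    rw [hΦ, hvo.toOpenPartialHomeomorph_left_inv, tY_of_not_mem A D z.2]
  · obtain ⟨m, rfl⟩ := exists_eq_j_inl_of_mem D hy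
    haveI : Nonempty X.offInr := ⟨⟨X.inl m, X.inl_not_mem_range_inr m⟩⟩
    set Φ := (isOpenEmbedding_eXY D).toOpenPartialHomeomorph (eXY D) with hΦ
    have hΦt : Φ.symm.source = range (eXY D) := by
      rw [OpenPartialHomeomorph.symm_source, hΦ, IsOpenEmbedding.toOpenPartialHomeomorph_target]
    have hΦs : ContMDiffOn (𝓡∂ (n + 1 + 1)) (𝓡∂ (n + 1 + 1)) ∞ Φ.symm Φ.symm.source := by
      rw [hΦt, hΦ]
      exact contMDiffOn_symm_of_isSmoothEmbedding (isSmoothEmbedding_eXY D) (isOpenEmbedding_eXY D)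
    have hΦs' : ContMDiffOn (𝓡∂ (n + 1 + 1)) (𝓡∂ (n + 1 + 1)) ∞ Φ.symm.symm Φ.symm.target := by
      rw [OpenPartialHomeomorph.symm_symm, OpenPartialHomeomorph.symm_target, hΦ,
        IsOpenEmbedding.toOpenPartialHomeomorph_apply]
      exact (isSmoothEmbedding_eXY D).contMDiff.contMDiffOn
    have hmem : D.j (X.inl m) ∈ Φ.symm.source := by
      rw [hΦt]
      exact ⟨⟨X.inl m, X.inl_not_mem_range_inr m⟩, rfl⟩
    have h0 : Manifold.IsImmersionAtOfComplement PUnit.{1} (𝓡∂ (n + 1 + 1)) (𝓡∂ (n + 1 + 1)) ∞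
        (fA A D) (Φ.symm (D.j (X.inl m))) :=
      (isSmoothEmbedding_fA A D).isImmersionAtOfComplement_punit rfl _
    have h1 := h0.comp_openPartialHomeomorph Φ.symm hΦs hΦs' hmem
    refine h1.congr_of_eventuallyEq ?_
    filter_upwards [Φ.symm.open_source.mem_nhds hmem] with y' hy'
    rw [hΦt] at hy'
    obtain ⟨z, rfl⟩ := hy'
    show fA A D (Φ.symm (eXY D z)) = tY A D (eXY D z)
    rw [hΦ, (isOpenEmbedding_eXY D).toOpenPartialHomeomorph_left_inv]
    show (extGlueData A D).inl _ = tY A D (D.j z.val)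
    rw [tY_j A D z.2]

/-- `tV` is `C^∞`. [folklore] -/
theorem contMDiff_tV : ContMDiff (𝓡∂ (n + 1 + 1)) (𝓡∂ (n + 1 + 1)) ∞ (tV A D) := fun v =>
  (isImmersionAtOfComplement_tV A D v).contMDiffAt

/-- `tY` is `C^∞`. [folklore] -/
theorem contMDiff_tY : ContMDiff (𝓡∂ (n + 1 + 1)) (𝓡∂ (n + 1 + 1)) ∞ (tY A D) := fun y =>
  (isImmersionAtOfComplement_tY A D y).contMDiffAt

/-- `tV` is continuous. [folklore] -/
theorem continuous_tV : Continuous (tV A D) := (contMDiff_tV A D).continuous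

/-- `tY` is continuous. [folklore] -/
theorem continuous_tY : Continuous (tY A D) := (contMDiff_tY A D).continuous

/-- **`T` is compact.** [folklore] -/
instance compactSpace_T : CompactSpace (T A D) := by
  haveI : CompactSpace V := A.compactSpace
  refine ⟨?_⟩
  rw [← range_tV_union_range_tY A D]
  exact (isCompact_range (continuous_tV A D)).union (isCompact_range (continuous_tY A D))

/-- **`T` is second countable.** [folklore] -/
instance secondCountable_T : SecondCountableTopology (T A D) :=
  (extGlueData A D).secondCountableTopologyH

/-- **`tV : V → T` is a smooth embedding.** [folklore] -/
theorem isSmoothEmbedding_tV :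
    Manifold.IsSmoothEmbedding (𝓡∂ (n + 1 + 1)) (𝓡∂ (n + 1 + 1)) ∞ (tV A D) := by
  haveI : CompactSpace V := A.compactSpace
  exact ⟨Manifold.IsImmersionOfComplement.isImmersion fun v => isImmersionAtOfComplement_tV A D v,
    ((continuous_tV A D).isClosedEmbedding (injective_tV A D)).isEmbedding⟩

/-- **`tY : Y → T` is a smooth embedding.** [folklore] -/
theorem isSmoothEmbedding_tY :
    Manifold.IsSmoothEmbedding (𝓡∂ (n + 1 + 1)) (𝓡∂ (n + 1 + 1)) ∞ (tY A D) :=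
  ⟨Manifold.IsImmersionOfComplement.isImmersion fun y => isImmersionAtOfComplement_tY A D y,
    ((continuous_tY A D).isClosedEmbedding (injective_tY A D)).isEmbedding⟩

/-- **The boundary of `T` is the far end of `Y`.** [folklore] -/
theorem boundary_T : (𝓡∂ (n + 1 + 1)).boundary (T A D) = range (tY A D ∘ Y.inr) := by
  rw [(extGlueData A D).boundary_glued_eq]
  have hA : (𝓡∂ (n + 1 + 1)).boundary (intOpens (n := n) V) = ∅ := by
    rw [ModelWithCorners.boundary_open, eq_empty_iff_forall_notMem]
    intro p hp
    have : p.val ∉ (𝓡∂ (n + 1 + 1)).boundary V := by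
      rw [← ModelWithCorners.compl_interior, mem_compl_iff, not_not]
      exact p.2
    exact this hp
  rw [hA, image_empty, empty_union]
  ext q
  constructor
  · rintro ⟨p, hp, rfl⟩
    rw [ModelWithCorners.boundary_open] at hp
    obtain ⟨y, hy⟩ := Y.mem_range_inr_of_mem_boundary hp p.2
    refine ⟨y, ?_⟩
    show tY A D (Y.inr y) = _
    rw [tY_of_not_mem A D (hy.symm ▸ p.2 : Y.inr y ∉ range Y.inl)]
    congr 1
    exact Subtype.ext hy
  · rintro ⟨p, rfl⟩
    have hp : Y.inr p ∉ range Y.inl := fun h =>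
      Set.disjoint_left.1 Y.disjoint_range h (mem_range_self p)
    refine ⟨⟨Y.inr p, hp⟩, ?_, (tY_of_not_mem A D hp).symm⟩
    rw [ModelWithCorners.boundary_open]
    exact Y.inr_mem_boundary p

/-! ### The two attachment structures on `T` -/

/-- The piece `W` in `T`: `inl` of the corestriction of `jW`. [folklore] -/
def tW (w : W) : T A D := (extGlueData A D).inl ⟨A.jW w, A.isInteriorPoint_jW w⟩

/-- `tW w = tV (jW w)`. [folklore] -/
theorem tW_eq (w : W) : tW A D w = tV A D (A.jW w) := (tV_jW A D w).symm

/-- `tW` is a smooth embedding. [folklore] -/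
theorem isSmoothEmbedding_tW :
    Manifold.IsSmoothEmbedding (𝓡∂ (n + 1 + 1)) (𝓡∂ (n + 1 + 1)) ∞ (tW A D) :=
  (extGlueData A D).isSmoothEmbedding_inl_compH
    (isSmoothEmbedding_codRestrict_of_forall_mem A.isSmoothEmbedding_jW (intOpens (n := n) V)
      A.isInteriorPoint_jW)

/-- The far end of `Y` in `T`: `inr` of the corestriction of `inr`. [folklore] -/
theorem isSmoothEmbedding_tY_comp_inr :
    Manifold.IsSmoothEmbedding (𝓡 (n + 1)) (𝓡∂ (n + 1 + 1)) ∞ (tY A D ∘ Y.inr) := by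
  have hp : ∀ p, Y.inr p ∉ range Y.inl := fun p h =>
    Set.disjoint_left.1 Y.disjoint_range h (mem_range_self p)
  have h := (extGlueData A D).isSmoothEmbedding_inr_compH
    (isSmoothEmbedding_codRestrict_of_forall_mem Y.isSmoothEmbedding_inr Y.offInl hp)
  have heq : (tY A D ∘ Y.inr) = (extGlueData A D).inr ∘ fun p => (⟨Y.inr p, hp p⟩ : Y.offInl) := by
    funext p
    exact tY_of_not_mem A D (hp p)
  rw [heq]
  exact h

/-- **`T` is an attachment of `Y` to `W` along `ψ`**: pieces `tW = tV ∘ jW` and `tY`.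
[cite: MilnorHCobordism1965, §1, Thm. 1.4] -/
def extensionAttachmentY : CobordismAttachment b Y ψ (T A D) where
  jW := tW A D
  jX := tY A D
  isSmoothEmbedding_jW := isSmoothEmbedding_tW A D
  isSmoothEmbedding_jX := isSmoothEmbedding_tY A D
  range_union := by
    apply eq_univ_of_univ_subset
    rw [← range_tV_union_range_tY A D]
    refine union_subset ?_ subset_union_right
    rintro _ ⟨v, rfl⟩
    rcases A.exists_jW_eq_or v with ⟨w, rfl⟩ | ⟨x, rfl⟩
    · exact Or.inl ⟨w, tW_eq A D w⟩
    · exact Or.inr ⟨D.j x, (tV_jX_eq_tY_j A D x).symm⟩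
  jW_eq_jX_iff w y := by
    rw [tW_eq, tV_eq_tY_iff]
    constructor
    · rintro ⟨x, hx, rfl⟩
      obtain ⟨z, rfl, rfl⟩ := (A.jW_eq_jX_iff w x).1 hx
      exact ⟨z, rfl, D.j_inl (ψ z)⟩
    · rintro ⟨z, rfl, rfl⟩
      exact ⟨X.inl (ψ z), A.jW_incl z, (D.j_inl (ψ z)).symm⟩
  isSmoothEmbedding_jX_comp_inr := isSmoothEmbedding_tY_comp_inr A D
  range_jX_comp_inr := (boundary_T A D).symm

/-- The piece `W` of `extensionAttachmentY` is `tV ∘ jW`. [folklore] -/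
@[simp] theorem extensionAttachmentY_jW (w : W) : (extensionAttachmentY A D).jW w = tV A D (A.jW w) :=
  tW_eq A D w

/-- The piece `Y` of `extensionAttachmentY` is `tY` (definitional). [folklore] -/
@[simp] theorem extensionAttachmentY_jX : (extensionAttachmentY A D).jX = tY A D := rfl

/-- The second cobordism in `T`: `tY ∘ j′ = inr ∘ (corestriction of j′)`. [folklore] -/
theorem isSmoothEmbedding_tY_comp_j' :
    Manifold.IsSmoothEmbedding (𝓡∂ (n + 1 + 1)) (𝓡∂ (n + 1 + 1)) ∞ (tY A D ∘ D.j') := by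
  have h := (extGlueData A D).isSmoothEmbedding_inr_compH
    (isSmoothEmbedding_codRestrict_of_forall_mem D.isSmoothEmbedding_j' Y.offInl
      D.j'_not_mem_range_inl)
  have heq : (tY A D ∘ D.j') =
      (extGlueData A D).inr ∘ fun x' => (⟨D.j' x', D.j'_not_mem_range_inl x'⟩ : Y.offInl) := by
    funext x'
    exact tY_of_not_mem A D (D.j'_not_mem_range_inl x')
  rw [heq]
  exact h

variable [IsManifold (𝓡 (n + 1)) ∞ N]

/-- **`T` is an attachment of `X′` to `V` along the identity of `∂V = N`**: pieces `tV` and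
`tY ∘ j′`. [cite: MilnorHCobordism1965, §1, Thm. 1.4] -/
def extensionAttachmentX' : CobordismAttachment A.boundaryData X' (Diffeomorph.refl (𝓡 (n + 1)) N ∞)
    (T A D) where
  jW := tV A D
  jX := tY A D ∘ D.j'
  isSmoothEmbedding_jW := isSmoothEmbedding_tV A D
  isSmoothEmbedding_jX := isSmoothEmbedding_tY_comp_j' A D
  range_union := by
    apply eq_univ_of_univ_subset
    rw [← range_tV_union_range_tY A D]
    refine union_subset subset_union_left ?_
    rintro _ ⟨y, rfl⟩
    rcases D.range_union.symm.subset (mem_univ y) with ⟨x, rfl⟩ | ⟨x', rfl⟩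
    · exact Or.inl ⟨A.jX x, tV_jX_eq_tY_j A D x⟩
    · exact Or.inr ⟨x', rfl⟩
  jW_eq_jX_iff v x' := by
    rw [comp_apply, tV_eq_tY_iff]
    constructor
    · rintro ⟨x, rfl, hx⟩
      obtain ⟨y, rfl, rfl⟩ := (D.j_eq_j'_iff x x').1 hx.symm
      exact ⟨y, rfl, rfl⟩
    · rintro ⟨y, rfl, rfl⟩
      exact ⟨X.inr y, rfl, (D.j_inr y).symm⟩
  isSmoothEmbedding_jX_comp_inr := by
    have : (tY A D ∘ D.j') ∘ X'.inr = tY A D ∘ Y.inr := by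
      funext p
      simp only [comp_apply, D.j'_inr]
    rw [this]
    exact isSmoothEmbedding_tY_comp_inr A D
  range_jX_comp_inr := by
    have : (tY A D ∘ D.j') ∘ X'.inr = tY A D ∘ Y.inr := by
      funext p
      simp only [comp_apply, D.j'_inr]
    rw [this]
    exact (boundary_T A D).symm

/-- The piece `V` of `extensionAttachmentX'` is `tV` (definitional). [folklore] -/
@[simp] theorem extensionAttachmentX'_jW : (extensionAttachmentX' A D).jW = tV A D := rfl

/-- The piece `X′` of `extensionAttachmentX'` is `tY ∘ j′` (definitional). [folklore] -/
@[simp] theorem extensionAttachmentX'_jX (x' : X'.W) :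
    (extensionAttachmentX' A D).jX x' = tY A D (D.j' x') := rfl

end Extension

end CobordismAttachment

end Literature.Topology.FourManifolds

end
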